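import Summits.SmoothPoincare4.SmoothPoincare4.Theorems.SblfDescentRungOneHelperFoldNFPageHessianChart
import HarnessLib

/-!
# A fold box about the round point: the torus side is the outside of the cone, and the tube
# slice is linearised by the chart

Helper layer `helper_timelike_foldBox` of stub `helper_foldNF_timelike` (the untwistedness of
the round `1`-handle; towards the essentiality of the vanishing cycle, `helper_timelike_essential`),
line `Sketch`, crux `SblfDescent.RungOne`.

(Crux item stmt-SmoothPoincare4-18531; skeleton `Cruxes/RungOne/Lines/Sketch.lean`.)

Let `f : X → S²` be a genus-one Lefschetz-free SBLF with equatorial round image, `v` the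
torus-side pole, `e` the round circle by longitude, `ν₀` any tube about it and
`g (t, x) = ⟪v, f (ν₀ (circlePt t, x))⟫`.  For a fold chart `(φ, ψ)` centred at the round point
`q₊ = e (circlePt 0)` (Hayano 2011, Def. 2.1 (4)) we record (`helper_timelike_foldBox`):
* a box `‖φ‖ < δ` inside which **the torus side `{⟪f, v⟫ > 0}` is exactly the outside
  `x₁² + x₂² > x₃²` of the double cone** — the base height `Λ = ⟪v, ·⟫ ∘ ψ⁻¹` vanishes on the
  axis and has `∂ₛΛ > 0` near `0` (the torus side is the side `s > 0` of the fold,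
  `mul_fderiv_symm_pos_of_fold_chart`), so `Λ (t, s)` has the sign of `s`;
* the page Hessian `H_0 (a, b) = λ · 2 Q (D (0, a), D (0, b))`, `λ > 0`, with `D` the
  differential at `(0, 0)` of the chart reading `w = φ ∘ ν₀ ∘ (circlePt × id)` of the tube
  (the computation of `helper_foldNF_pageHessianAt`, with `D` exposed);
* the **linearisation of the tube slice by the chart**: `‖φ (ν₀ (circlePt 0, x)) - D (0, x)‖ ≤ c ‖x‖`
  for `‖x‖` small.

## References

* K. Hayano, *On genus-1 simplified broken Lefschetz fibrations*, Algebr. Geom. Topol. 11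
  (2011), Def. 2.1 (4). [Hayano2011]
* R. İ. Baykur, S. Kamada, *Classification of broken Lefschetz fibrations with small fiber
  genera*, J. Math. Soc. Japan 67 (2015), §2. [BaykurKamada2015]
-/

set_option linter.dupNamespace false

noncomputable section

open scoped Manifold ContDiff Topology RealInnerProductSpace
open Set Function Filter Metric Literature.Topology.FourManifolds
  Literature.AlgebraicTopology.SingularHomology
  Literature.Topology.FourManifolds.IsSimplifiedBrokenLefschetzFibration

namespace Summit.SmoothPoincare4.SmoothPoincare4.Cruxes.RungOne.Sketch

/-- Local notation: `𝔼 n` is the model Euclidean space `EuclideanSpace ℝ (Fin n)`. -/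
local notation "𝔼 " n:arg => EuclideanSpace ℝ (Fin n)

/-- Local notation: `𝕊²`, the unit sphere of `ℝ³`. -/
local notation "𝕊²" => (Metric.sphere (0 : EuclideanSpace ℝ (Fin 3)) (1 : ℝ))

/-- Local notation: the indefinite fold normal form `(t, x₁, x₂, x₃) ↦ (t, x₁² + x₂² - x₃²)`. -/
local notation "foldNF" => (fun v : EuclideanSpace ℝ (Fin 4) =>
    (WithLp.toLp 2 ![v 0, v 1 ^ 2 + v 2 ^ 2 - v 3 ^ 2] : EuclideanSpace ℝ (Fin 2)))

attribute [local instance] Literature.Topology.FourManifolds.fact_finrank_euclideanSpace_succ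

/-- **A function of one variable vanishing at `0` with positive derivative on an interval about
`0` has the sign of its argument there.** [folklore] -/
theorem pos_iff_of_deriv_pos {φ : ℝ → ℝ} {d : ℝ} (hd : 0 < d) (hφ0 : φ 0 = 0)
    (hderiv : ∀ s ∈ Ioo (-d) d, ∃ φ' : ℝ, HasDerivAt φ φ' s ∧ 0 < φ') {s : ℝ} (hs : s ∈ Ioo (-d) d) :
    (0 < φ s ↔ 0 < s) := by
  have hmono : StrictMonoOn φ (Ioo (-d) d) := by
    refine strictMonoOn_of_deriv_pos (convex_Ioo _ _) (fun x hx => ?_) fun x hx => ?_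
    · obtain ⟨φ', h, -⟩ := hderiv x hx
      exact h.continuousAt.continuousWithinAt
    · rw [interior_Ioo] at hx
      obtain ⟨φ', h, hpos⟩ := hderiv x hx
      rwa [h.deriv]
  have h0 : (0 : ℝ) ∈ Ioo (-d) d := ⟨by linarith, hd⟩
  constructor
  · intro h
    by_contra hle
    push Not at hle
    rcases eq_or_lt_of_le hle with h0' | h0'
    · rw [h0', hφ0] at h; exact lt_irrefl _ h
    · have := hmono hs h0 h0'
      rw [hφ0] at this
      linarith
  · intro h
    have := hmono h0 hs h
    rwa [hφ0] at this

set_option maxHeartbeats 800000 in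
/-- **The fold box about the round point.**  For a genus-one Lefschetz-free SBLF with equatorial
round image, torus-side pole `v`, round circle `e` and tube `ν₀`: there are a chart `φ` of `X`
centred at `q₊ = e (circlePt 0)` (the total-space chart of a fold chart), a continuous linear
`D : ℝ × ℝ³ → ℝ⁴`, `λ > 0` and `δ > 0` with `B(0, δ) ⊆ φ.target`, such that (i) inside the box
`‖φ p‖ < δ` the torus side `{⟪f, v⟫ > 0}` is `{(φ p)₁² + (φ p)₂² > (φ p)₃²}`, (ii) the page
Hessian of `g (t, x) = ⟪v, f (ν₀ (circlePt t, x))⟫` at `(0, 0)` is `λ · 2 Q (D (0, ·), D (0, ·))`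
(`Q` the index-one form on the last three coordinates), and (iii) the chart linearises the tube
slice: for every `c > 0`, `‖φ (ν₀ (circlePt 0, x)) - D (0, x)‖ ≤ c ‖x‖` for `‖x‖` small.
[cite: Hayano2011, Def. 2.1 (4)] [cite: BaykurKamada2015, §2] -/
theorem helper_timelike_foldBox : ∀ (X : Type) [TopologicalSpace X] [T2Space X] [SecondCountableTopology X] [CompactSpace X] [ChartedSpace (𝔼 4) X] [IsManifold (𝓡 4) ∞ X] (o : SmoothOrientation (𝓡 4) X) (f : X → 𝕊²), IsSimplifiedBrokenLefschetzFibration o f ∅ 0 → f '' ({p : X | ¬ Surjective (mfderiv (𝓡 4) (𝓡 2) f p)} \ (↑(∅ : Finset X) : Set X)) = sphereEquator 1 → ∀ (v : 𝕊²), (v : 𝔼 3) 0 = 0 → (v : 𝔼 3) 1 = 0 → (∀ y : 𝕊², ⟪(y : 𝔼 3), (v : 𝔼 3)⟫ < 0 → (∀ q, f q = y → Surjective (mfderiv (𝓡 4) (𝓡 2) f q)) ∧ Nonempty ((Fin (2 * 0) → ℤ) ≃ₗ[ℤ] singularHomology ℤ ℤ ↥(f ⁻¹' {y}) 1)) → (∀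 y : 𝕊², ⟪(y : 𝔼 3), ((-v : 𝕊²) : 𝔼 3)⟫ < 0 → (∀ q, f q = y → Surjective (mfderiv (𝓡 4) (𝓡 2) f q)) ∧ Nonempty ((Fin (2 * (0 + 1)) → ℤ) ≃ₗ[ℤ] singularHomology ℤ ℤ ↥(f ⁻¹' {y}) 1)) → ∀ (e : Metric.sphere (0 : 𝔼 2) 1 → X) (ν₀ : CircleNbhd (𝓡 4) e), Set.range e = {p : X | ¬ Surjective (mfderiv (𝓡 4) (𝓡 2) f p)} \ (↑(∅ : Finset X) : Set X) → (∀ u, f (e u) = sphereInclusion 1 2 one_le_two u) → ∃ (φ : OpenPartialHomeomorph X (𝔼 4)) (D : (ℝ × 𝔼 3) →L[ℝ] 𝔼 4) (lam δ : ℝ), e (circlePt 0) ∈ φ.source ∧ φ (e (circlePt 0)) = 0 ∧ 0 < lam ∧ 0 < δ ∧ Metric.ball (0 : 𝔼 4) δ ⊆ φ.target ∧ (∀ p ∈ φ.source, ‖φ p‖ < δ → (0 < ⟪((f p : 𝕊²) : 𝔼 3), (v : 𝔼 3)⟫ ↔ 0 < (φ p) 1 ^ 2 + (φ p) 2 ^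 2 - (φ p) 3 ^ 2)) ∧ (∀ a b : 𝔼 3, fderiv ℝ (fderiv ℝ (fun q : ℝ × 𝔼 3 => SphereHeight.height (v : 𝔼 3) (f (ν₀.toFun (circlePt q.1, q.2))))) ((0 : ℝ), (0 : 𝔼 3)) ((0 : ℝ), a) ((0 : ℝ), b) = lam * (2 * ((D ((0 : ℝ), a)) 1 * (D ((0 : ℝ), b)) 1 + (D ((0 : ℝ), a)) 2 * (D ((0 : ℝ), b)) 2 - (D ((0 : ℝ), a)) 3 * (D ((0 : ℝ), b)) 3))) ∧ (∀ c : ℝ, 0 < c → ∃ η : ℝ, 0 < η ∧ ∀ x : 𝔼 3, ‖x‖ < η → ν₀.toFun (circlePt 0, x) ∈ φ.source ∧ ‖φ (ν₀.toFun (circlePt 0, x)) - D ((0 : ℝ), x)‖ ≤ c * ‖x‖) := by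
  intro X _ _ _ _ _ _ o f hf hround v hv0 hv1 hlo hhi e ν₀ hrange hfe
  set e₀ : EuclideanSpace ℝ (Fin 2) := EuclideanSpace.single (0 : Fin 2) (1 : ℝ) with he₀
  set e₁ : EuclideanSpace ℝ (Fin 2) := EuclideanSpace.single (1 : Fin 2) (1 : ℝ) with he₁
  -- the tube map on the universal cover and the round base point `q₊ = e (circlePt 0)`
  set W : ℝ × 𝔼 3 → X := fun q => ν₀.toFun (circlePt q.1, q.2) with hW
  have hPms : ContMDiff 𝓘(ℝ, ℝ × 𝔼 3) ((𝓡 1).prod 𝓘(ℝ, 𝔼 3)) ∞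
      fun q : ℝ × 𝔼 3 => ((circlePt q.1, q.2) : (Metric.sphere (0 : 𝔼 2) 1) × 𝔼 3) :=
    contMDiff_circlePt_prod
  have hWs : ContMDiff 𝓘(ℝ, ℝ × 𝔼 3) (𝓡 4) ∞ W := ν₀.isSmoothEmbedding.contMDiff.comp hPms
  have hW0 : ∀ t : ℝ, W (t, 0) = e (circlePt t) := fun t => by simp [hW, ν₀.apply_zero]
  set q₀ : X := e (circlePt 0) with hq₀def
  have hq₀Z : q₀ ∈ {p : X | ¬ Surjective (mfderiv (𝓡 4) (𝓡 2) f p)} \ (↑(∅ : Finset X) : Set X) :=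
    hrange ▸ mem_range_self _
  obtain ⟨φ, ψ, hq, hq0, hmaps, hφ, hφs, hψ, hψs, hmodel⟩ :=
    hf.fold q₀ hq₀Z.1 (Finset.notMem_empty _)
  obtain ⟨hΓ, hS, hE, hinj, hΓ0⟩ :=
    hf.sphereGerm_of_fold_chart hround hq hq0 hmaps hφ hφs hψ hψs hmodel
  set Γ : EuclideanSpace ℝ (Fin 2) → EuclideanSpace ℝ (Fin 3) :=
    fun w => ((ψ.symm w : 𝕊²) : 𝔼 3) with hΓdef
  -- the base height `Λ = ⟪v, ·⟫ ∘ ψ⁻¹`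
  set Λ : EuclideanSpace ℝ (Fin 2) → ℝ := SphereHeight.height (v : 𝔼 3) ∘ ψ.symm with hΛdef
  have hΛΓ : Λ = (innerSL ℝ (v : 𝔼 3) : 𝔼 3 →L[ℝ] ℝ) ∘ Γ := height_comp_symm_eq ψ (v : 𝔼 3)
  have hvin : ∀ w : 𝔼 3, ⟪(v : 𝔼 3), w⟫ = (v : 𝔼 3) 2 * w 2 := fun w => by
    rw [BandFoliation.inner_eq_three, hv0, hv1]; ring
  have hΓd : DifferentiableAt ℝ Γ 0 := hΓ.differentiableAt (by simp)
  have hΛ0 : fderiv ℝ Λ 0 e₀ = 0 := by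
    rw [hΛΓ, fderiv_inner_comp_apply _ hΓd, hvin, SphereGerm.fderiv_single_zero_two hΓ hE, mul_zero]
  have hΛ00 : fderiv ℝ (fderiv ℝ Λ) 0 e₀ e₀ = 0 := by
    rw [hΛΓ, fderiv_fderiv_inner_comp_apply _ hΓ, hvin,
      SphereGerm.fderiv_fderiv_single_zero_two hΓ hE, mul_zero]
  set lam : ℝ := fderiv ℝ Λ 0 e₁ with hlamdef
  have hlam : lam = (v : 𝔼 3) 2 * fderiv ℝ Γ 0 e₁ 2 := by
    rw [hlamdef, hΛΓ, fderiv_inner_comp_apply _ hΓd, hvin]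
  -- `lam > 0`: the torus side is the side `s > 0` (round point of the meridian slice `y₁ = 0`)
  have hlampos : 0 < lam := by
    have hx1 : ((f q₀ : 𝕊²) : 𝔼 3) 1 = 0 := by
      rw [hq₀def, hfe, (coe_sphereInclusion_circlePt 0).2.1]
      simp
    rw [hlam]
    exact mul_fderiv_symm_pos_of_fold_chart hf hround hv0 hv1 hlo hhi hx1 hq hq0 hmaps hφ hφs
      hψ hψs hmodel
  -- `Λ` is `C^∞` at `0 = ψ (f q₀)`, hence `C¹` on a ball about `0`
  have hψ0 : ψ (f q₀) = 0 := base_apply_eq_zero_of_fold_chart hmodel hq hq0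
  have h0t : (0 : EuclideanSpace ℝ (Fin 2)) ∈ ψ.target := hψ0 ▸ ψ.map_source (hmaps hq)
  have hΛs : ContDiffAt ℝ ∞ Λ 0 := contDiffAt_comp_symm_of_chart hψs (SphereHeight.contMDiff_height _) h0t
  obtain ⟨U₁, hU₁o, h0U₁, hΛ1⟩ := hΛs.contDiffWithinAt.contDiffOn' (m := 1) (by exact_mod_cast le_top)
    (by intro h; exact absurd h (by simp))
  rw [insert_eq_of_mem (mem_univ _), univ_inter] at hΛ1
  have hΛdc : ContinuousOn (fderiv ℝ Λ) U₁ := hΛ1.continuousOn_fderiv_of_isOpen hU₁o le_rfl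
  -- `∂ₛΛ > 0` and `Λ (t, 0) = 0` on a box about `0`
  set pt : ℝ → ℝ → EuclideanSpace ℝ (Fin 2) := fun t s => t • e₀ + s • e₁ with hpt
  have hptc : Continuous fun q : ℝ × ℝ => pt q.1 q.2 := by simp only [hpt]; fun_prop
  have hpt0 : pt 0 0 = 0 := by simp [hpt]
  obtain ⟨d₁, hd₁, hbox₁⟩ : ∃ d₁ > 0, ∀ t s : ℝ, |t| < d₁ → |s| < d₁ →
      pt t s ∈ U₁ ∧ 0 < fderiv ℝ Λ (pt t s) e₁ ∧ Λ (pt t 0) = 0 := by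
    -- `U₁ ∩ {∂ₛΛ > 0}` is an open neighbourhood of `0`; `Λ (t e₀) = 0` eventually
    have hO : IsOpen (U₁ ∩ (fun w => fderiv ℝ Λ w e₁) ⁻¹' Ioi 0) :=
      (hΛdc.clm_apply continuousOn_const).isOpen_inter_preimage hU₁o isOpen_Ioi
    have h0O : (0 : EuclideanSpace ℝ (Fin 2)) ∈ U₁ ∩ (fun w => fderiv ℝ Λ w e₁) ⁻¹' Ioi 0 :=
      ⟨h0U₁, by change 0 < fderiv ℝ Λ 0 e₁; exact hlampos⟩
    have hpre : ∀ᶠ q : ℝ × ℝ in 𝓝 (0, 0), pt q.1 q.2 ∈ U₁ ∩ (fun w => fderiv ℝ Λ w e₁) ⁻¹' Ioi 0 :=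
      hptc.continuousAt.preimage_mem_nhds (by rw [hpt0]; exact hO.mem_nhds h0O)
    have hax : ∀ᶠ t : ℝ in 𝓝 0, Λ (pt t 0) = 0 := by
      filter_upwards [hE] with t ht
      simp only [hpt, zero_smul, add_zero]
      change SphereHeight.height (v : 𝔼 3) (ψ.symm (t • e₀)) = 0
      rw [SphereHeight.height_apply, hvin]
      change (v : 𝔼 3) 2 * Γ (t • e₀) 2 = 0
      rw [ht, mul_zero]
    obtain ⟨ε₁, hε₁, hb₁⟩ := Metric.eventually_nhds_iff.1 hpre
    obtain ⟨ε₂, hε₂, hb₂⟩ := Metric.eventually_nhds_iff.1 hax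
    refine ⟨min ε₁ ε₂, lt_min hε₁ hε₂, fun t s ht hs => ?_⟩
    have hts : dist ((t, s) : ℝ × ℝ) (0, 0) < ε₁ := by
      rw [Prod.dist_eq, Real.dist_eq, Real.dist_eq, sub_zero, sub_zero]
      exact max_lt (ht.trans_le (min_le_left _ _)) (hs.trans_le (min_le_left _ _))
    have h1 := hb₁ hts
    have h2 : Λ (pt t 0) = 0 := hb₂ (by rw [Real.dist_eq, sub_zero]; exact ht.trans_le (min_le_right _ _))
    exact ⟨h1.1, h1.2, h2⟩
  have hsign : ∀ t s : ℝ, |t| < d₁ → |s| < d₁ → (0 < Λ (pt t s) ↔ 0 < s) := by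
    intro t s ht hs
    refine pos_iff_of_deriv_pos (φ := fun s => Λ (pt t s)) hd₁ (hbox₁ t 0 ht (by simpa using hd₁)).2.2
      (fun s' hs' => ?_) (s := s) ⟨by linarith [abs_lt.1 hs |>.1], (abs_lt.1 hs).2⟩
    have hs'' : |s'| < d₁ := abs_lt.2 ⟨hs'.1, hs'.2⟩
    obtain ⟨hU, hpos, -⟩ := hbox₁ t s' ht hs''
    have hΛd : DifferentiableAt ℝ Λ (pt t s') := (hΛ1.differentiableOn one_ne_zero _ hU).differentiableAt
      (hU₁o.mem_nhds hU)
    have hc : HasDerivAt (fun s : ℝ => pt t s) e₁ s' := by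
      simp only [hpt]
      have := ((hasDerivAt_id s').smul_const e₁).const_add (t • e₀)
      simpa using this
    exact ⟨_, hΛd.hasFDerivAt.comp_hasDerivAt s' hc, hpos⟩
  -- the base point of `f p` in the chart: `ψ (f p) = pt ((φ p) 0) (Q (φ p))`
  have hbase : ∀ p ∈ φ.source, ψ (f p) = pt ((φ p) 0) ((φ p) 1 ^ 2 + (φ p) 2 ^ 2 - (φ p) 3 ^ 2) := by
    intro p hp
    obtain ⟨h0, h1⟩ := hmodel p hp
    ext i
    fin_cases i
    · simpa [hpt, he₀, he₁] using h0
    · simpa [hpt, he₀, he₁] using h1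
  have hheight : ∀ p ∈ φ.source, ⟪((f p : 𝕊²) : 𝔼 3), (v : 𝔼 3)⟫ =
      Λ (pt ((φ p) 0) ((φ p) 1 ^ 2 + (φ p) 2 ^ 2 - (φ p) 3 ^ 2)) := by
    intro p hp
    rw [real_inner_comm, ← SphereHeight.height_apply, ← hbase p hp]
    change _ = SphereHeight.height (v : 𝔼 3) (ψ.symm (ψ (f p)))
    rw [ψ.left_inv (hmaps hp)]
  -- the box `‖φ‖ < δ ⊆ φ.target`, small enough for the sign lemma
  obtain ⟨δ₀, hδ₀, hballδ₀⟩ := Metric.isOpen_iff.1 φ.open_target 0 (hq0 ▸ φ.map_source hq)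
  set δ : ℝ := min (min δ₀ d₁) (min 1 d₁) with hδdef  -- `δ ≤ δ₀`, `δ ≤ d₁`, `δ ≤ 1` so `δ² ≤ δ ≤ d₁`
  have hδ : 0 < δ := lt_min (lt_min hδ₀ hd₁) (lt_min one_pos hd₁)
  have hδδ₀ : δ ≤ δ₀ := (min_le_left _ _).trans (min_le_left _ _)
  have hδd₁ : δ ≤ d₁ := (min_le_left _ _).trans (min_le_right _ _)
  have hδ1 : δ ≤ 1 := (min_le_right _ _).trans (min_le_left _ _)
  have hcoord : ∀ (u : 𝔼 4) (i : Fin 4), |u i| ≤ ‖u‖ := fun u i => by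
    rw [EuclideanSpace.norm_eq]
    refine Real.abs_le_sqrt ?_
    rw [Fin.sum_univ_four]
    simp only [Real.norm_eq_abs, sq_abs]
    fin_cases i <;> simp <;> nlinarith [sq_nonneg (u 0), sq_nonneg (u 1), sq_nonneg (u 2), sq_nonneg (u 3)]
  -- the chart reading `w = φ ∘ W` of the tube and its differential at `(0, 0)`
  set w : ℝ × 𝔼 3 → 𝔼 4 := fun q => φ (W q) with hwdef
  have hWq₀ : W (0, 0) = q₀ := hW0 0
  have hφat : ContMDiffAt (𝓡 4) (𝓡 4) ∞ φ q₀ := (hφ q₀ hq).contMDiffAt (φ.open_source.mem_nhds hq)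
  have hws : ContMDiffAt 𝓘(ℝ, ℝ × 𝔼 3) 𝓘(ℝ, 𝔼 4) ∞ w (0, 0) :=
    ContMDiffAt.comp (0, 0) (by rw [hWq₀]; exact hφat) (hWs _)
  have hws' : ContDiffAt ℝ ∞ w (0, 0) := contMDiffAt_iff_contDiffAt.1 hws
  have hw0 : w (0, 0) = 0 := by simp only [hwdef, hWq₀, hq0]
  set D : (ℝ × 𝔼 3) →L[ℝ] 𝔼 4 := fderiv ℝ w (0, 0) with hDdef
  -- the Hessian at `(0, 0)` through the chart (the computation of `helper_foldNF_pageHessianAt`)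
  have hN0 : foldNF (0 : 𝔼 4) = 0 := by ext i; fin_cases i <;> simp
  have hax0 : (0 : 𝔼 4) 1 = 0 ∧ (0 : 𝔼 4) 2 = 0 ∧ (0 : 𝔼 4) 3 = 0 := by simp
  have hΛs2 : ContDiffAt ℝ 2 Λ (foldNF (0 : 𝔼 4)) := by rw [hN0]; exact hΛs.of_le (by norm_cast)
  have hΛN1 : fderiv ℝ (Λ ∘ foldNF) 0 = 0 := by
    ext u
    rw [fderiv_comp_foldNormalForm_apply (hΛs2.differentiableAt (by simp)) hax0 u, hN0, hΛ0,
      mul_zero, zero_apply]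
  have hΛN2 : ∀ p q : 𝔼 4, fderiv ℝ (fderiv ℝ (Λ ∘ foldNF)) 0 p q =
      lam * (2 * (p 1 * q 1 + p 2 * q 2 - p 3 * q 3)) := fun p q => by
    rw [fderiv_fderiv_comp_foldNormalForm_apply hΛs2 hax0 p q, hN0, hΛ00, zero_mul, zero_add]
  have hΛNs : ContDiffAt ℝ 2 (Λ ∘ foldNF) 0 := hΛs2.comp 0 (contDiffAt_foldNormalForm_two 0)
  have hsrc : ∀ᶠ q in 𝓝 ((0, (0 : 𝔼 3)) : ℝ × 𝔼 3), W q ∈ φ.source :=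
    (hWs _).continuousAt.preimage_mem_nhds (by rw [hWq₀]; exact φ.open_source.mem_nhds hq)
  have hev : (fun q : ℝ × 𝔼 3 => SphereHeight.height (v : 𝔼 3) (f (ν₀.toFun (circlePt q.1, q.2)))) =ᶠ[𝓝 (0, 0)]
      (Λ ∘ foldNF) ∘ w := by
    filter_upwards [hsrc] with q hq'
    have h1 := comp_symm_eq_of_fold_chart (ℓ := SphereHeight.height (v : 𝔼 3)) hmaps hmodel
      (φ.map_source hq')
    simp only [comp_apply, φ.left_inv hq'] at h1
    exact h1
  have hD2 : ∀ V V' : ℝ × 𝔼 3,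
      fderiv ℝ (fderiv ℝ (fun q : ℝ × 𝔼 3 =>
        SphereHeight.height (v : 𝔼 3) (f (ν₀.toFun (circlePt q.1, q.2))))) (0, 0) V V' =
      lam * (2 * ((D V) 1 * (D V') 1 + (D V) 2 * (D V') 2 - (D V) 3 * (D V') 3)) := fun V V' => by
    rw [(hev.fderiv).fderiv_eq]
    have hΛNs' : ContDiffAt ℝ 2 (Λ ∘ foldNF) (w (0, 0)) := by rw [hw0]; exact hΛNs
    rw [fderiv_fderiv_comp_apply hΛNs' (hws'.of_le (by norm_cast)) V V', hw0, hΛN1,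
      zero_apply, add_zero, hΛN2]
  -- the linearisation of the slice by the chart
  have hlin : ∀ c : ℝ, 0 < c → ∃ η : ℝ, 0 < η ∧ ∀ x : 𝔼 3, ‖x‖ < η →
      ν₀.toFun (circlePt 0, x) ∈ φ.source ∧ ‖φ (ν₀.toFun (circlePt 0, x)) - D ((0 : ℝ), x)‖ ≤ c * ‖x‖ := by
    intro c hc
    have hwd : HasFDerivAt w D (0, 0) := (hws'.differentiableAt (by simp)).hasFDerivAt
    have hO := (hwd.isLittleO.def hc)
    rw [hw0] at hO
    obtain ⟨ε₁, hε₁, hb₁⟩ := Metric.eventually_nhds_iff.1 hO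
    obtain ⟨ε₂, hε₂, hb₂⟩ := Metric.eventually_nhds_iff.1 hsrc
    refine ⟨min ε₁ ε₂, lt_min hε₁ hε₂, fun x hx => ?_⟩
    have hdist : dist (((0 : ℝ), x) : ℝ × 𝔼 3) (0, 0) = ‖x‖ := by
      rw [Prod.dist_eq, dist_self, dist_zero_right]
      exact max_eq_right (norm_nonneg _)
    have h1 := hb₁ (y := ((0 : ℝ), x)) (by rw [hdist]; exact hx.trans_le (min_le_left _ _))
    have h2 := hb₂ (y := ((0 : ℝ), x)) (by rw [hdist]; exact hx.trans_le (min_le_right _ _))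
    simp only [sub_zero] at h1
    have hn : ‖(((0 : ℝ), x) : ℝ × 𝔼 3) - ((0 : ℝ), (0 : 𝔼 3))‖ = ‖x‖ := by
      rw [← dist_eq_norm, hdist]
    refine ⟨by simpa [hW] using h2, ?_⟩
    have : ‖w ((0 : ℝ), x) - D (((0 : ℝ), x) - ((0 : ℝ), (0 : 𝔼 3)))‖ ≤ c * ‖(((0 : ℝ), x) : ℝ × 𝔼 3) - ((0 : ℝ), (0 : 𝔼 3))‖ := h1
    rw [hn] at this
    simpa [hwdef, hW] using this
  -- conclusion
  refine ⟨φ, D, lam, δ, hq, hq0, hlampos, hδ, fun u hu => hballδ₀ (Metric.ball_subset_ball hδδ₀ hu),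
    fun p hp hpδ => ?_, fun a b => hD2 ((0 : ℝ), a) ((0 : ℝ), b), hlin⟩
  rw [hheight p hp]
  have ht : |(φ p) 0| < d₁ := (hcoord _ 0).trans_lt (hpδ.trans_le hδd₁)
  have hQ : |(φ p) 1 ^ 2 + (φ p) 2 ^ 2 - (φ p) 3 ^ 2| < d₁ := by
    have h1 := hcoord (φ p) 1
    have h2 := hcoord (φ p) 2
    have h3 := hcoord (φ p) 3
    have hn1 : ‖φ p‖ < 1 := hpδ.trans_le hδ1
    have hsq : ‖φ p‖ ^ 2 ≤ ‖φ p‖ := by nlinarith [norm_nonneg (φ p)]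
    have hn2 : ‖φ p‖ ^ 2 = (φ p) 0 ^ 2 + (φ p) 1 ^ 2 + (φ p) 2 ^ 2 + (φ p) 3 ^ 2 := by
      rw [EuclideanSpace.norm_eq, Real.sq_sqrt (Finset.sum_nonneg fun i _ => by positivity),
        Fin.sum_univ_four]
      simp [sq_abs]
    rw [abs_lt]
    constructor <;> nlinarith [sq_nonneg ((φ p) 0), sq_abs ((φ p) 1), sq_abs ((φ p) 2), sq_abs ((φ p) 3),
      hpδ.trans_le hδd₁]
  exact hsign _ _ ht hQ

end Summit.SmoothPoincare4.SmoothPoincare4.Cruxes.RungOne.Sketch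

end
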